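import Literature.AlgebraicGeometry.Motives.AbelianVarietyKernelCotangent          -- the engine `Hom.exists_cotangentEquiv_ker`
import Literature.AlgebraicGeometry.AbelianSchemes.PDivisibleGroupFunctor               -- ★ `torsion`, `torsionGrpObj`, `torsionMap`, `torsionMap_ι`
import Literature.AlgebraicGeometry.AbelianSchemes.AbelianSchemeOverField               -- ★ `AbelianScheme.toAbelianVariety`
import HarnessLib

/-!
# `cot(A[N]) = cot(A)` for `N = 0` in `k`; `cot(A[pⁿ]) = cot(A)` in characteristic `p` — the unit cotangent space of the torsion of an abelian scheme

Topic `Literature/AlgebraicGeometry/Motives`; namespace `Literature.AlgebraicGeometry.Motives`.  THEOREMS ONLY (no definition, no named fact, no instance, no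
notation, no `sorry`).  Cell `hodgecm-mathlib` (D-0151), P6 «MOD programme», K∕BT cut v2 «BLOCK-AT-A-POINT» DEAL 2 (F0P6d-plan (g2) → B-p12 (g32)) «THE
COTANGENT SPACE OF A KERNEL; `cot(A[pⁿ]) = cot(A)` IN CHARACTERISTIC `p`»: the HEAD over the engine ★ `Motives/AbelianVarietyKernelCotangent`, in the
currency of the P6b kit `Lines/F0_P6b_BlockNumerics.lean` (`htan`∕`hdim`: `Module.finrank k (RingHom.ker (Γ(η_{B.G n}))).Cotangent`) and of ★ p846312
`BarsottiTateGroupFixedPartCotangent.finrank_cotangent_fixLayer_eq` (DEAL 1, B-p08: the `ε`-block's unit cotangent rank = `dim range (cotangent map of ε)`).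
HC_CM is proved only modulo the printed citations (2 remaining named inputs hLiu418, h413) until rung 0 closes; this file is count-neutral.

THE PRINT.  [GortzWedhorn2023] Remark 27.18 (3) (p. 611): `T_e([n]_X) = n`; Proposition 27.188 (1): `X[n]` is a finite (locally free) group scheme;
[Tate1967] §2 (2.1): the `p`-divisible group `(A[pⁿ])ₙ` of an abelian scheme; [GortzWedhorn2020] (6.4) Definition 6.2: the cotangent space at a rational
point.  CONSEQUENCE PROVED HERE: for `N ≠ 0` with `N = 0` in `k` (e.g. `N = pⁿ`, `char k = p`, `n ≥ 1`) the closed immersion `A[N] ↪ A` identifies the unit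
cotangent space of the finite `k`-group scheme `A[N]` with `𝔪_{A,e} ∕ 𝔪_{A,e}²`, `Aut`-equivariantly: `dim_k I_e(A[N]) ∕ I_e(A[N])² = dim A`, and for every
group-scheme endomorphism `v` of `A` the rank of `Γ(v|_{A[N]})^*` on `I_e ∕ I_e²` equals the rank of `v^*` on `𝔪_{A,e} ∕ 𝔪_{A,e}²` (so an idempotent `e_w`
of an `𝒪_F`-action cuts out a block of the dimension read off the Lie algebra — the `ε`-block docking of DEAL 1 §2).

WHAT IS HERE (`𝒜 : AbelianSchemeOver (Spec k)`, `[IsCommMonObj 𝒜.X]`, `A := 𝒜.toAffine.toAbelianVariety`): `nsmul_id_hom_eq_mulN` (`(N • 𝟙 A) = [N]`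
underlies `𝒜.mulN N`), `cotangentMap_nsmul_id_eq_zero`, `isAffine_torsion_left`; HEAD **`exists_cotangentEquiv_torsion`** (`∃ Φ : I_e(A[N]) ∕ I_e² ≃ₗ[k]
Cotangent A` with `Φ ∘ Γ(torsionMap v N)^* = v^* ∘ Φ`); **`finrank_cotangent_unitAugIdeal_torsion`** (`= dim A`); **`finrank_range_mapCotangent_torsionMap_eq`**
(docking); `exists_cotangentEquiv_torsion_primePow`, `finrank_cotangent_unitAugIdeal_torsion_primePow` (`N = pⁿ` under `[CharP k p]`; the layer
`(𝒜.pDivisibleGroup hp hg).G n` is `𝒜.torsion (p ^ n)` by `rfl`).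

## References
* [GortzWedhorn2023] U. Görtz, T. Wedhorn, *Algebraic Geometry II* (2023) — Remark 27.18 (3) (p. 611), Proposition 27.188 (1).
* [Tate1967] J. T. Tate, *p-divisible groups*, Proc. Conf. Local Fields (Driebergen, 1966), Springer (1967) — §2 (2.1).
* [GortzWedhorn2020] U. Görtz, T. Wedhorn, *Algebraic Geometry I* (2nd ed., 2020) — (6.4) Definition 6.2.
-/

set_option autoImplicit false

noncomputable section

universe u

open CategoryTheory CategoryTheory.Limits AlgebraicGeometry MonoidalCategory CartesianMonoidalCategory
open IsLocalRing
open scoped MonObj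

namespace Literature.AlgebraicGeometry.Motives

/-! ## §6 `cot(A[N]) ≅ cot(A)` for `N = 0` in `k`; `cot(A[pⁿ]) ≅ cot(A)` in characteristic `p`; equivariance and ranks -/

section Torsion

open AbelianVariety Literature.AlgebraicGeometry.AbelianSchemes Literature.AlgebraicGeometry.AbelianSchemes.AbelianSchemeOver
open Literature.AlgebraicGeometry.GroupSchemes Literature.AlgebraicGeometry.GroupSchemes.AffineGroupScheme

variable {k : Type u} [Field k] (𝒜 : AbelianSchemeOver (Spec (.of k))) [IsCommMonObj 𝒜.X]

omit [IsCommMonObj 𝒜.X] in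
/-- `[N]` of the abelian variety `𝒜_k` has underlying group-scheme homomorphism `mulN N = (𝟙)^N` of the abelian scheme `𝒜`.
[cite: GortzWedhorn2023, Remark 27.18 (3) (p. 611)] -/
theorem nsmul_id_hom_eq_mulN (N : ℕ) : (N • 𝟙 𝒜.toAffine.toAbelianVariety).hom.hom.hom = 𝒜.mulN N := by
  have h := AbelianVariety.comp_nsmul_id (A := 𝒜.toAffine.toAbelianVariety) (𝟙 _) N
  rw [Category.id_comp] at h
  rw [h, mulN_def]
  rfl

omit [IsCommMonObj 𝒜.X] in
/-- `[N]^* = N = 0` on `𝔪_e/𝔪_e²` when `N = 0` in `k` (★ `cotangentMap_zsmul_id_eq_smul`: `[n]^* = n`). [cite: GortzWedhorn2023, Remark 27.18 (3) (p. 611)] -/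
theorem cotangentMap_nsmul_id_eq_zero {N : ℕ} (hNk : (N : k) = 0) :
    AbelianVariety.Hom.cotangentMap (N • 𝟙 𝒜.toAffine.toAbelianVariety) = 0 := by
  rw [← cotangentMap_eq_hom_cotangentMap, cotangentMap_nsmul, cotangentMap_id, ← Nat.cast_smul_eq_nsmul k, hNk, zero_smul]

omit [IsCommMonObj 𝒜.X] in
/-- `A[N]` is affine (finite over `k`) for `N ≠ 0`. [cite: GortzWedhorn2023, Prop. 27.188 (1)] -/
theorem isAffine_torsion_left {N : ℕ} (hN : N ≠ 0) : IsAffine (𝒜.torsion N).left :=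
  haveI := 𝒜.isFinite_torsion_hom hN
  isAffine_of_isAffineHom (𝒜.torsion N).hom

/-- **`cot(A[N]) ≅ cot(A)` FOR `N = 0` IN `k`, EQUIVARIANTLY.**  For an abelian scheme `𝒜` over `Spec k` (`k` a field) and `N ≠ 0` with `N = 0` in
`k`, there is a `k`-linear isomorphism `Φ` from the unit cotangent space `I_e/I_e²` of the affine `k`-group scheme `A[N] = 𝒜.torsion N` (★ `htan`∕`hdim`
currency of the P6b block-numerics kit) onto `𝔪_{A,e}/𝔪_{A,e}² = AbelianVariety.Cotangent 𝒜.toAffine.toAbelianVariety`, such that for every group-scheme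
endomorphism `v` of `𝒜` (e.g. `act.i a` of a ring action), `Φ ∘ Γ(v|_{A[N]})^* = v^* ∘ Φ` with `v|_{A[N]} =` ★ `torsionMap v N` and `v^*` the cotangent map of
`v` as an endomorphism of the abelian variety: `[N]^* = N = 0` on `𝔪_e/𝔪_e²`, so the engine applies. [cite: GortzWedhorn2020, (6.4) Definition 6.2]
[cite: GortzWedhorn2023, Prop. 27.188 (1)] -/
theorem exists_cotangentEquiv_torsion {N : ℕ} (hN : N ≠ 0) (hNk : (N : k) = 0) :
    letI := 𝒜.torsionGrpObj N
    ∃ Φ : (RingHom.ker ((η[𝒜.torsion N] : 𝟙_ (Over (Spec (.of k))) ⟶ _).left.appTop.hom) : Ideal (Alg (𝒜.torsion N))).Cotangent ≃ₗ[k] Cotangent 𝒜.toAffine.toAbelianVariety,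
      ∀ (v : 𝒜.X ⟶ 𝒜.X) [IsMonHom v],
        haveI := isMonHom_torsionMap v N
        Φ.toLinearMap ∘ₗ Ideal.mapCotangent _ _ (Alg.comap (torsionMap v N)) (ker_unit_le_comap _) =
          AbelianVariety.cotangentMap 𝒜.toAffine.toAbelianVariety (InducedCategory.homMk (Grp.ofHom (A := 𝒜.X) (B := 𝒜.X) v)) ∘ₗ Φ.toLinearMap := by
  letI := 𝒜.torsionGrpObj N
  obtain ⟨Φ, hΦ⟩ := Hom.exists_cotangentEquiv_ker (N • 𝟙 𝒜.toAffine.toAbelianVariety) (𝒜.mulN N) (𝒜.isMonHom_mulN N)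
    (nsmul_id_hom_eq_mulN 𝒜 N) (cotangentMap_nsmul_id_eq_zero 𝒜 hNk) (haff := isAffine_torsion_left 𝒜 hN)
  refine ⟨Φ, fun v _ => ?_⟩
  exact @hΦ (InducedCategory.homMk (Grp.ofHom (A := 𝒜.X) (B := 𝒜.X) v)) (torsionMap v N) (isMonHom_torsionMap v N)
    (torsionMap_ι v N)

/-- **`dim_k I_e(A[N])/I_e(A[N])² = dim A`** for `N ≠ 0`, `N = 0` in `k`: the embedding dimension of `A[N]` at the unit is the full dimension of `A`
(★ `finrank_cotangent`). [cite: GortzWedhorn2020, (6.4) Definition 6.2] -/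
theorem finrank_cotangent_unitAugIdeal_torsion {N : ℕ} (hN : N ≠ 0) (hNk : (N : k) = 0) :
    letI := 𝒜.torsionGrpObj N
    Module.finrank k (RingHom.ker ((η[𝒜.torsion N] : 𝟙_ (Over (Spec (.of k))) ⟶ _).left.appTop.hom) : Ideal (Alg (𝒜.torsion N))).Cotangent = 𝒜.toAffine.toAbelianVariety.dim := by
  letI := 𝒜.torsionGrpObj N
  obtain ⟨Φ, -⟩ := exists_cotangentEquiv_torsion 𝒜 hN hNk
  rw [Φ.finrank_eq, finrank_cotangent]

/-- **Docking for the `ε`-block (★ `finrank_cotangent_fixLayer_eq`): `dim range(Γ(v|_{A[N]})^*) = dim range(v^*)`** for every group-scheme endomorphism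
`v` of `𝒜` — the unit cotangent rank cut out by `v` on `A[N]` is the rank it cuts out on `𝔪_{A,e}/𝔪_{A,e}²`. [cite: GortzWedhorn2020, (6.4) Definition 6.2] -/
theorem finrank_range_mapCotangent_torsionMap_eq {N : ℕ} (hN : N ≠ 0) (hNk : (N : k) = 0) (v : 𝒜.X ⟶ 𝒜.X) [IsMonHom v] :
    letI := 𝒜.torsionGrpObj N
    haveI := isMonHom_torsionMap v N
    Module.finrank k (LinearMap.range (Ideal.mapCotangent _ _ (Alg.comap (torsionMap v N)) (ker_unit_le_comap _))) =
      Module.finrank k (LinearMap.range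
        (AbelianVariety.cotangentMap 𝒜.toAffine.toAbelianVariety (InducedCategory.homMk (Grp.ofHom (A := 𝒜.X) (B := 𝒜.X) v)))) := by
  letI := 𝒜.torsionGrpObj N
  haveI := isMonHom_torsionMap v N
  obtain ⟨Φ, hΦ⟩ := exists_cotangentEquiv_torsion 𝒜 hN hNk
  have h := hΦ v
  have h1 := LinearMap.range_comp (Ideal.mapCotangent _ _ (Alg.comap (torsionMap v N)) (ker_unit_le_comap _)) Φ.toLinearMap
  have h2 : LinearMap.range (AbelianVariety.cotangentMap 𝒜.toAffine.toAbelianVariety (InducedCategory.homMk (Grp.ofHom (A := 𝒜.X) (B := 𝒜.X) v)) ∘ₗ Φ.toLinearMap) =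
      LinearMap.range (AbelianVariety.cotangentMap 𝒜.toAffine.toAbelianVariety (InducedCategory.homMk (Grp.ofHom (A := 𝒜.X) (B := 𝒜.X) v))) :=
    LinearMap.range_comp_of_range_eq_top _ Φ.range
  rw [← LinearEquiv.finrank_map_eq Φ, ← h1, h, h2]

/-- **`cot(A[pⁿ]) ≅ cot(A)` IN CHARACTERISTIC `p`** (`n ≥ 1`), equivariantly — the layers `A[pⁿ]` of the `p`-divisible group ★ `pDivisibleGroup` carry
the full cotangent space of `A`. [cite: GortzWedhorn2020, (6.4) Definition 6.2] [cite: Tate1967, §2.2] -/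
theorem exists_cotangentEquiv_torsion_primePow (p n : ℕ) [hp : Fact p.Prime] [CharP k p] (hn : n ≠ 0) :
    letI := 𝒜.torsionGrpObj (p ^ n)
    ∃ Φ : (RingHom.ker ((η[𝒜.torsion (p ^ n)] : 𝟙_ (Over (Spec (.of k))) ⟶ _).left.appTop.hom) :
        Ideal (Alg (𝒜.torsion (p ^ n)))).Cotangent ≃ₗ[k] Cotangent 𝒜.toAffine.toAbelianVariety,
      ∀ (v : 𝒜.X ⟶ 𝒜.X) [IsMonHom v],
        haveI := isMonHom_torsionMap v (p ^ n)
        Φ.toLinearMap ∘ₗ Ideal.mapCotangent _ _ (Alg.comap (torsionMap v (p ^ n))) (ker_unit_le_comap _) =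
          AbelianVariety.cotangentMap 𝒜.toAffine.toAbelianVariety (InducedCategory.homMk (Grp.ofHom (A := 𝒜.X) (B := 𝒜.X) v)) ∘ₗ Φ.toLinearMap :=
  exists_cotangentEquiv_torsion 𝒜 (pow_ne_zero n hp.out.ne_zero) (by rw [Nat.cast_pow, CharP.cast_eq_zero k p, zero_pow hn])

/-- **`dim_k I_e(A[pⁿ])/I_e(A[pⁿ])² = dim A`** in characteristic `p`, `n ≥ 1`. [cite: GortzWedhorn2020, (6.4) Definition 6.2] [cite: Tate1967, §2.2] -/
theorem finrank_cotangent_unitAugIdeal_torsion_primePow (p n : ℕ) [hp : Fact p.Prime] [CharP k p] (hn : n ≠ 0) :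
    letI := 𝒜.torsionGrpObj (p ^ n)
    Module.finrank k (RingHom.ker ((η[𝒜.torsion (p ^ n)] : 𝟙_ (Over (Spec (.of k))) ⟶ _).left.appTop.hom) :
        Ideal (Alg (𝒜.torsion (p ^ n)))).Cotangent = 𝒜.toAffine.toAbelianVariety.dim :=
  finrank_cotangent_unitAugIdeal_torsion 𝒜 (pow_ne_zero n hp.out.ne_zero) (by rw [Nat.cast_pow, CharP.cast_eq_zero k p, zero_pow hn])

end Torsion

end Literature.AlgebraicGeometry.Motives

end
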